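import Summits.CriticalPhenomena.CardyFormulaZ2.Theorems.CardyComplexConeParafermionToSLESixFamiliesDefs
import Literature.Probability.RandomPlanarGeometry.ParaObservableSLESix
import HarnessLib

/-!
# Stub `stub_sleSixOfLimitData` of line `caratheodory-net-slit-uniformity` (crux `ParafermionToSLESixFamilies`, stmt-CriticalPhenomena-11389)

Route `CardyComplexCone` (sub-problem `CriticalPhenomena/CardyFormulaZ2`), crux
`Summit.CriticalPhenomena.CardyFormulaZ2.Theses.CardyComplexCone.ParafermionToSLESixFamilies`.
This file proves the registered stub `stub_sleSixOfLimitData : SleSixOfLimitData` of the checked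
skeleton `Cruxes/ParafermionToSLESixFamilies/Lines/caratheodory_net_slit_uniformity.lean` — the
purely continuum `κ = 6` step "limit data (J′)+(D) for the spin-1/3 observable ⟹ the
subsequential limit `ν` is the chordal SLE₆ law": for one Dobrushin domain, one chordal
uniformizing map `φ`, `ν`-a.e. Loewner describability and source `a`, discrete driving
processes `V^k → drivingFunction φ` in distribution, and the discrete martingale approximation
`ParaMartingaleApprox V` of the time-limited spin-1/3 half-plane observable
`paraObservableProcess`, conclude `IsSLELaw 6 D ν`.

The whole argument is the Literature theorem
`Literature.Probability.RandomPlanarGeometry.isSLELaw_six_of_limitData`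
(`RandomPlanarGeometry/ParaObservableSLESix.lean`, the `κ = 6` twin of
`LatticeModels.isSLELaw_three_of_limitData`), stated there for the explicit expression
`((iy) g_t'(iy)/(g_t(iy) - W_t))^{1/3}` at time `t ∧ y²/9`, which is by `rfl` the body of the
route's `paraObservableProcess` / `paraObservable`: far-field expansion of the cube root of the
Loewner density (`ParaObservableFarField.lean`), natural-filtration martingales from the cylinder
identity and localisation at far-field stopping times giving the local martingales `W`,
`W² - 6t` (`ParaObservableProcess.lean`, `ParaObservableLocalMartingale.lean`), the limit
passage from discrete martingales (`ParaObservableLimitPassage.lean`), Lévy's characterisation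
and the `κ`-local SLE identification with the Rohde–Schramm inputs at `κ = 6`
(`isSLELaw_of_isLocalMartingale_driving_of_ae_tendsto`, `tendsto_norm_sleTrace_atTop_of_ne_eight`).

Sources: H. Duminil-Copin, arXiv:1208.3787, p. 9 (spin `1/3`, `κ = 6`); D. Chelkak et al.,
C. R. Math. 352 (2014), §3 (the method); A. Kemppainen, S. Smirnov, Ann. Probab. 45 (2017),
Thm. 1.5 / Cor. 1.7.
-/

namespace Summit.CriticalPhenomena.CardyFormulaZ2.Cruxes.ParafermionToSLESixFamilies.CaratheodoryNetSlitUniformity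

open MeasureTheory Literature.Probability.RandomPlanarGeometry

/-- **SLE₆ from the limit data** (registered stub `stub_sleSixOfLimitData` of line
`caratheodory-net-slit-uniformity`): for one limit law `ν` and one chordal uniformizing map `φ`
of a Dobrushin domain `D`, the data (J′) — `ν`-a.e. Loewner describability through `φ`, source
`a`, convergence in distribution of continuous-path processes `V^k` to `drivingFunction φ` — and
(D) — `ParaMartingaleApprox V`, the discrete martingale approximation of the time-limited
spin-1/3 observable `paraObservableProcess (V k) y` — identify `ν` as the chordal SLE₆ law:
`IsSLELaw 6 D ν`. Proof: `isSLELaw_six_of_limitData` (the hypotheses match by unfolding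
`ParaMartingaleApprox`, `paraObservableProcess`, `paraObservable`, `Pc`).
(source: DuminilCopin2012Parafermion, p. 9) (source: CDHKSCRAS2014, §3) -/
theorem stub_sleSixOfLimitData : SleSixOfLimitData := by
  intro D φ hφ ν _ hdesc hsrc V hVc hlaw hD
  exact isSLELaw_six_of_limitData hφ hdesc hsrc hVc hlaw hD

end Summit.CriticalPhenomena.CardyFormulaZ2.Cruxes.ParafermionToSLESixFamilies.CaratheodoryNetSlitUniformity
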